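/-
Origin: expansion seat `prover-pub-hodgecm-mc-binder-1-g10-0`, handover #32 2026-08-20T05:56Z md5 ef89f0b1aab4 (NEW additive KERNEL leaf, 2 rfl theorems: the W pin of record `Gen12Pins.Wg … @τSyl @TSyl @hTSyl` unfolded = binder-2's `HypCensus.Wcm` body, pointwise and as families; imports RUN-37 rows only; drop alone) (`HOME/mc/pub-hodgecm-mc-binder-1-g10/stage42/HodgeCM/Model/Binders/WgSylvester.lean`, md5 ef89f0b1aab4, 54 lines);
landed by the second packager p2 gen 3 (p2-g3) in gate run 42 as `HodgeCM/Model/Binders/WgSylvester.lean` (verbatim).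
-/
/-
Origin: speedrun cell pub-hodgecm, MODEL-CONSTRUCTION sub-cell, unit pub-hodgecm-mc-binder-1-g10 (BINDER PROVER, gen 10; W pin of record),
seat prover-pub-hodgecm-mc-binder-1-g10-0, 2026-08-20.  Target in PKG: HodgeCM/Model/Binders/WgSylvester.lean (NEW additive leaf; imports
#22 `Binders/Gen12SeesawKInfty` + #26a `Binders/WmInputGuarded` (RUN 37)).  KERNEL ONLY: two `rfl` theorems; 0 records, nothing cited, 0 `def … : Prop`, MODEL-N ±0, E unchanged.
-/
import Summits.HodgeConjecture.HodgeCM.Model.Binders.Gen12SeesawKInfty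
import Summits.HodgeConjecture.HodgeCM.Model.Binders.WmInputGuarded

/-!
# The W pin of record at the Sylvester frame, unfolded (`rfl`)

glue-1-g9 (STATUS 2026-08-20T05:47:01Z) asks whether mc-binder-2's census W family
`HypCensus.Wcm hGR η hη hηc := fun V c => wmInputCM₂g V c.D (hGR V c) (η V c) (hη V c) (hηc V c) ι₁ V.sylvesterFrame (sylvesterFrame_formCongr V)`
and binder-1's pin family of record `Gen12Pins.Wg @hGR @η @hη @hηc @τSyl @TSyl @hTSyl` (rows 16/17's producers) are ONE family.  They are,
DEFINITIONALLY: `τSyl V c := ι₁`, `TSyl V c := V.sylvesterFrame` are `abbrev`s and `hTSyl V c` is a proof of the same proposition as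
`sylvesterFrame_formCongr V` (proof irrelevance).  This leaf records the unfolding as kernel-checked `rfl`s, pointwise and as families, so an
E child may pin `W := HypCensus.Wcm …` and consume the `Gen12Pins.*_total*` producers with no restatement.
-/

set_option autoImplicit false

noncomputable section

namespace HodgeCM.Model.Gen12Pins

open HodgeCM HodgeCM.Model
open Literature.NumberTheory.GelbartRogawski1991.UnitaryDualPair

variable
  (hGR : ∀ {L : CMField} {ι₁ : L →+* ℂ} (V : HermSpace3 L ι₁) (c : SeesawCtx L),
    (cmSplittingDatum (L : Type) finProdFinEquiv (frameD V) (frameD_real V) (frameD_ne V) (dW c.D) (dW_real c.D)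
      (dW_ne c.D)).CompatibleSplitting)
  (η : ∀ {L : CMField} {ι₁ : L →+* ℂ} (V : HermSpace3 L ι₁) (c : SeesawCtx L),
    CMAdelic (L : Type) (frameD V) × CMAdelic (L : Type) (dW c.D) →* ℂˣ)
  (hη : ∀ {L : CMField} {ι₁ : L →+* ℂ} (V : HermSpace3 L ι₁) (c : SeesawCtx L),
    ∀ γU ∈ CMRat (L : Type) (frameD V), ∀ γ ∈ CMRat (L : Type) (dW c.D), η V c (γU, γ) = 1)
  (hηc : ∀ {L : CMField} {ι₁ : L →+* ℂ} (V : HermSpace3 L ι₁) (c : SeesawCtx L), Continuous fun p => ((η V c p : ℂˣ) : ℂ))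

/-- **The W pin of record, unfolded at a context**: `Wg … V c` IS unitary-1's guarded record at `(ι₁, V.sylvesterFrame, sylvesterFrame_formCongr V)`
— the body of mc-binder-2's `HypCensus.Wcm hGR η hη hηc V c` — by `rfl`. -/
theorem Wg_syl_apply {L : CMField} {ι₁ : L →+* ℂ} (V : HermSpace3 L ι₁) (c : SeesawCtx L) :
    Wg @hGR @η @hη @hηc @τSyl @TSyl @hTSyl V c =
      wmInputCM₂g V c.D (hGR V c) (η V c) (hη V c) (hηc V c) ι₁ V.sylvesterFrame (sylvesterFrame_formCongr V) := rfl

/-- **The same as FAMILIES** (the shape of E's row-4 binder `W : ∀ {L ι₁} V c, WmInput V c.D`): the pin family of record equals the family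
`fun V c => wmInputCM₂g V c.D (hGR V c) (η V c) (hη V c) (hηc V c) ι₁ V.sylvesterFrame (sylvesterFrame_formCongr V)` (= `HypCensus.Wcm hGR η hη hηc`), by `rfl`. -/
theorem Wg_syl_eq :
    (fun {L : CMField} {ι₁ : L →+* ℂ} (V : HermSpace3 L ι₁) (c : SeesawCtx L) => Wg @hGR @η @hη @hηc @τSyl @TSyl @hTSyl V c) =
      fun {L : CMField} {ι₁ : L →+* ℂ} (V : HermSpace3 L ι₁) (c : SeesawCtx L) =>
        wmInputCM₂g V c.D (hGR V c) (η V c) (hη V c) (hηc V c) ι₁ V.sylvesterFrame (sylvesterFrame_formCongr V) := rfl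

end HodgeCM.Model.Gen12Pins

end
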